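import Mathlib
import HarnessLib
import Literature.MathematicalPhysics.StatisticalMechanics.RenormalisationMapRemainder
import Literature.MathematicalPhysics.StatisticalMechanics.RenormalisationMapRemainderRegroup
import Literature.MathematicalPhysics.StatisticalMechanics.RenormalisationMapP2FluctSplit
import Literature.MathematicalPhysics.StatisticalMechanics.RenormalisationMapP2Fluct
import Literature.MathematicalPhysics.StatisticalMechanics.NextHamiltonianBounds
import Literature.MathematicalPhysics.StatisticalMechanics.LinearisedMapLargePart
import Literature.MathematicalPhysics.StatisticalMechanics.StrongWeightABKM

/-!
# `S(H,K)(U) = blockPart(C_kK)(U) + Σ₁ + Σ₂ᴸ + Σ₃ + Σ₄` for the torus data ([ABKM19] Theorem 6.8 / Ch. 9.1)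

`GradientRG.nextKStep_sub_opC_eq` (RenormalisationMapRemainder) writes `K_{k+1}(U) − C_kK(U)` as four
explicit second-order sums, under abstract hypotheses (odd sides, `circulant 𝒞 ⪰ 0`, room for the test
polynomials, integrability of the `P₂(Z, φ+·)` and of `e^{−H(B,φ+·)}`, and the split
`R[P₂(X)] = RK(X) + R(e^{−H}−1)^X + R[rest(X)]`).  This file discharges all of them for the concrete torus
step data (`D.s = L^k`, `D.L = L`, `D.𝒞 = 𝒞_{k+1}`, reference block `B_{x₀}` and its box corner;
`‖H‖_{k,0} ≤ 1/8`, `‖K‖_k^{(A)} ≤ C`, `K` factorising with `K(∅) = 1`, local, `C^{r₀}`) and regroups the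
second sum with the large part of `C_kK` (`TorusPolymer.sum_large_regroup`, `opC = blockPart + largePart`):

* **`nextKStep_eq_blockPart_add_remainders_abkm`** —
  `S(H,K)(U,φ) = blockPart D K U φ + Σ₁(H̃,H,K) + Σ₂ᴸ(H̃,H,K) + Σ₃(H̃,H,K) + Σ₄(H̃,H,K)` with `H̃ = nextH D H K`,
  the four sums written exactly as in RenormalisationMapRemainderOne / TwoLarge / Three / Four.

This is the algebraic skeleton of the Lipschitz estimate of `S_k` (CH12-PLAN §5 (e3)): the difference
`S(H,K) − S(H',K')` is `blockPart D (K−K') U` plus the four Lipschitz-bounded remainder differences.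

Everything is proved; no named fact.

## References
* S. Adams, S. Buchholz, R. Kotecký, S. Müller, arXiv:1910.13564, Theorem 6.8, Ch. 9.1, Ch. 10.1
  [AdamsBuchholzKoteckyMuller2019].
-/

noncomputable section

namespace Literature.MathematicalPhysics.StatisticalMechanics.GradientRG

open scoped BigOperators Classical
open Finset MeasureTheory
open Literature.MathematicalPhysics.StatisticalMechanics.TorusPolymer
  (IsPolymer blocks polys bprod blockOf thicken reblock boxCorner mem_polys mem_blocks numBlocks isPolymer_blockOf
    card_blocks_eq_numBlocks blocks_blockOf empty_mem_polys reblock_empty subset_thicken sum_large_regroup)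
open Literature.Barriers.CriticalPhenomena.LongRangePhi4.Polymer (IsConn components)
open Literature.MathematicalPhysics.QuantumFieldTheory

variable {d M : ℕ} [NeZero M]

/-- **`S(H,K)(U) = blockPart(C_kK)(U) + Σ₁ + Σ₂ᴸ + Σ₃ + Σ₄` for the torus data** (module docstring):
`d ≥ 2`, `L` odd, `L ≥ 2^{d+3}+16R`, `M = L^N`, `k+1 ≤ N`, `p ≤ R`, `⌊d/2⌋+1 ≤ min(p, M_ord)`,
`θ̄, λ, δ₀, δ₁ > 0`, `h² ≥ h₀²`, `A > 0`; `‖H‖_{k,0} ≤ 1/8`; `U ≠ ∅`.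
[cite: AdamsBuchholzKoteckyMuller2019, Theorem 6.8 / Ch. 9.1 / Ch. 10.1 (10.1)–(10.3)] -/
theorem nextKStep_eq_blockPart_add_remainders_abkm {L N Mord R n p r₀ : ℕ} {θbar lam μ δ₁ δ₀ A𝒫 h A : ℝ}
    {𝒞 : ℕ → (Fin d → ZMod M) → ℝ} (hd : 2 ≤ d) (hLodd : Odd L) (hL : 2 ^ (d + 3) + 16 * R ≤ L)
    (hM : M = L ^ N) {k : ℕ} (hkN : k + 1 ≤ N) (hp : d / 2 + 1 ≤ p) (hpR : p ≤ R) (hMord : d / 2 + 1 ≤ Mord)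
    (hθbar : 0 < θbar) (hlam : 0 < lam)
    (hB : AbkmWeightBounds L N Mord R n θbar lam μ δ₁ δ₀ A𝒫 𝒞
      (abkmWeightData L N Mord R θbar (schedDelta δ₀ δ₁ N) 𝒞))
    (hδ₀ : 0 < δ₀) (hδ₁ : 0 < δ₁) (hh : 0 < h) (hh0 : hZeroSq d R δ₀ δ₁ ≤ h ^ 2) (hA : 0 < A)
    (D : StepData d M) (hDs : D.s = L ^ k) (hDL : D.L = L) (hD𝒞 : D.𝒞 = 𝒞 (k + 1))
    {x₀ : Fin d → ZMod M} (hB₀ : D.B₀ = blockOf (L ^ k) x₀) (hc₀ : D.c₀ = boxCorner (L ^ k) (starRad R L d k) x₀)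
    {H : RelevantHamiltonian ℂ d}
    (hH : hamNorm (fieldWt h (L : ℝ) d k) ((L : ℝ) ^ k) (L ^ (d * k)) H ≤ 1 / 8)
    {K : Finset (Fin d → ZMod M) → ((Fin d → ZMod M) → ℝ) → ℂ} {C : ℝ} (hC : 0 ≤ C)
    (hK : WeakNormLE (abkmNormParams L N Mord R p r₀ h θbar A (schedDelta δ₀ δ₁ N) 𝒞) k K C)
    (hKfac : Factorises (L ^ k) K) (hK0 : ∀ φ, K ∅ φ = 1) (hKd : ∀ Y, ContDiff ℝ r₀ (K Y))
    (hKloc : ∀ Y, IsPolymer (L ^ k) Y → IsConn Y →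
      IsGaugeLocal ((abkmNormParams L N Mord R p r₀ h θbar A (schedDelta δ₀ δ₁ N) 𝒞).gauge k Y) (K Y))
    {U : Finset (Fin d → ZMod M)} (hUne : U.Nonempty) (φ : (Fin d → ZMod M) → ℝ) :
    nextKStep D H K U φ =
      blockPart D K U φ +
      (∑ B ∈ blockPartIndex D U,
        ((bprod (L ^ k) (fun B' => expNegH (nextH D H K) B' φ) (U \ B) *
              bprod (L ^ k) (fun B' => expNegH (-(nextH D H K)) B' φ) (B \ U) - 1) * blockTerm D K B φ +
          bprod (L ^ k) (fun B' => expNegH (nextH D H K) B' φ) (U \ B) *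
              bprod (L ^ k) (fun B' => expNegH (-(nextH D H K)) B' φ) (B \ U) *
            (fluctDefect (𝒞 (k + 1)) H B φ +
              (expNegH (stepOpA (gradCov (𝒞 (k + 1))) H) B φ - 1) * (1 - Complex.exp (-(eval (opB D K) B φ))) -
              (Complex.exp (-(eval (opB D K) B φ)) - 1 + eval (opB D K) B φ)) +
          bprod (L ^ k) (fun B' => expNegH (nextH D H K) B' φ) (U \ B) *
              bprod (L ^ k) (fun B' => expNegH (-(nextH D H K)) B' φ) (B \ U) *
            fluct (𝒞 (k + 1)) (fun ψ => ∑ Y ∈ ((polys (L ^ k) B).erase B).erase ∅,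
              bprod (L ^ k) (fun B' => expNegH H B' ψ - 1) (B \ Y) * K Y ψ) φ)) +
      (∑ X ∈ largePartIndex (L ^ k) L U,
        bprod (L ^ k) (fun B => expNegH (nextH D H K) B φ) (U \ X) *
            bprod (L ^ k) (fun B => expNegH (-(nextH D H K)) B φ) (X \ U) *
          (fluct (𝒞 (k + 1)) (polyP2 (L ^ k) H K X) φ + bprod (L ^ k) (fun B => 1 - expNegH (nextH D H K) B φ) X)) +
      (∑ X ∈ ((polys (L ^ k) univ).filter (fun X => reblock (L ^ k) (L * L ^ k) X = U)).filter
          (fun X => ¬ IsConn X),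
        bprod (L ^ k) (fun B => expNegH (nextH D H K) B φ) (U \ X) *
            bprod (L ^ k) (fun B => expNegH (-(nextH D H K)) B φ) (X \ U) *
          (fluct (𝒞 (k + 1)) (polyP2 (L ^ k) H K X) φ + bprod (L ^ k) (fun B => 1 - expNegH (nextH D H K) B φ) X)) +
      ∑ X ∈ (polys (L ^ k) univ).filter (fun X => reblock (L ^ k) (L * L ^ k) X = U),
        ∑ X₁ ∈ ((polys (L ^ k) X).erase X).erase ∅,
          bprod (L ^ k) (fun B => expNegH (nextH D H K) B φ) (U \ X) *
            bprod (L ^ k) (fun B => expNegH (-(nextH D H K)) B φ) (X \ U) *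
            (bprod (L ^ k) (fun B => 1 - expNegH (nextH D H K) B φ) X₁ *
              fluct (𝒞 (k + 1)) (polyP2 (L ^ k) H K (X \ X₁)) φ) := by
  set P := abkmNormParams L N Mord R p r₀ h θbar A (schedDelta δ₀ δ₁ N) 𝒞 with hP
  set W := abkmWeightData L N Mord R θbar (schedDelta δ₀ δ₁ N) 𝒞 with hW
  have hL0 : (0 : ℝ) < L := by exact_mod_cast hLodd.pos
  have hk1 : k + 1 ≤ N + 1 := by omega
  have hk : k ≤ N := by omega
  have hMo : Odd M := by rw [hM]; exact hLodd.pow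
  have hsodd : Odd (L ^ k) := hLodd.pow
  obtain ⟨t, ht⟩ : ∃ t, N = k + t := ⟨N - k, by omega⟩
  have hMt : M = L ^ k * L ^ t := by rw [← pow_add, ← ht]; exact hM
  have htodd : Odd (L ^ t) := hLodd.pow
  have h𝔥 : 0 < fieldWt h (L : ℝ) d k := fieldWt_pos hh hL0 d k
  have hRk : (0 : ℝ) < (L : ℝ) ^ k := by positivity
  -- the step data is the concrete one: substitute its fields
  obtain ⟨s, L', 𝒸, c₀, B₀⟩ := D
  simp only at hDs hDL hD𝒞 hB₀ hc₀
  subst s L' 𝒸 c₀ B₀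
  -- the hypotheses of `nextKStep_sub_opC_eq`
  have hC𝒞 : (Matrix.circulant (𝒞 (k + 1))).PosSemidef := posSemidef_circulant_abkm hB hk1
  have hBne : (blockOf (L ^ k) x₀ : Finset (Fin d → ZMod M)).card ≠ 0 :=
    (card_pos.2 ⟨x₀, TorusPolymer.mem_blockOf_self _ x₀⟩).ne'
  obtain ⟨hwrap0, hroom0⟩ := abkm_box_lt (d := d) hL hpR hkN
  have hwrap : 4 * ((L ^ k - 1) / 2 + starRad R L d k) < M := by rw [hM]; exact hwrap0
  have hroomB : ∀ x ∈ blockOf (L ^ k) x₀, HasRoom (boxCorner (L ^ k) (starRad R L d k) x₀) x (d / 2 + 1) := by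
    intro x hx
    have hxS : x ∈ thicken (starRad R L d k) (blockOf (L ^ k) x₀) := subset_thicken _ _ hx
    have hin := (TorusPolymer.mem_thicken_blockOf_iff_inBox hMt hLodd.pow htodd hwrap x₀ x).1 hxS
    refine TorusPolymer.hasRoom_of_inBox hin ?_
    have h2 : ((2 * ((L ^ k - 1) / 2 + starRad R L d k) : ℕ) + ((d / 2 + 1 : ℕ) : ℤ)) * 2 < (M : ℤ) := by
      have : (2 * ((L ^ k - 1) / 2 + starRad R L d k) + (d / 2 + 1)) * 2 < M := by
        rw [hM]; have := hroom0; omega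
      exact_mod_cast this
    exact_mod_cast h2
  -- integrability of `P₂(Z, φ + ·)`
  have hint : ∀ Z, IsPolymer (L ^ k) Z →
      Integrable (fun ξ => polyP2 (L ^ k) H K Z (φ + ξ)) (stepMeasure (𝒞 (k + 1))) := by
    intro Z hZ
    have hb := tayNormLE_polyP2_abkm (p := p) (r₀ := r₀) hd hLodd hM hkN hp hMord hB hδ₀ hδ₁ hh hh0 hA hZ hH hC hK
      hKfac hK0 hKd hKloc
    have hc : 0 ≤ ∑ Y ∈ polys (L ^ k) Z, (∏ _B ∈ blocks (L ^ k) (Z \ Y),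
        8 * Real.exp (1 / 4) * hamNorm (fieldWt h (L : ℝ) d k) ((L : ℝ) ^ k) (L ^ (d * k)) H) *
        ∏ Z' ∈ components Y, C * P.aFactor k Z' := by
      refine sum_nonneg fun Y _ => mul_nonneg (prod_nonneg fun _ _ => ?_) (prod_nonneg fun Z' _ => ?_)
      · have := hamNorm_nonneg h𝔥.le hRk.le (L ^ (d * k)) H; positivity
      · exact mul_nonneg hC (WeakNormLE.aFactor_pos hA k Z').le
    exact integrable_comp_add_of_tayNormLE hb hc (contDiff_polyP2 (L ^ k) H hKd Z)
      (isGaugeLocal_polyP2_abkm (p := p) (r₀ := r₀) (θbar := θbar) (A := A) (δ := schedDelta δ₀ δ₁ N) (𝒞 := 𝒞)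
        (N := N) (Mord := Mord) (R := R) hLodd hM hk hh hp H hKfac hK0 hKloc hZ)
      (weightSectionDominated_abkm hθbar hlam hB hk1 Z (P.gauge k Z)) φ
  -- the split of `R[P₂(X)]`
  have hsplit : ∀ X ∈ (polys (L ^ k) univ).filter (fun X => reblock (L ^ k) (L * L ^ k) X = U),
      fluct (𝒞 (k + 1)) (polyP2 (L ^ k) H K X) φ =
        fluct (𝒞 (k + 1)) (K X) φ + fluct (𝒞 (k + 1)) (fun ψ => bprod (L ^ k) (fun B => expNegH H B ψ - 1) X) φ +
          fluct (𝒞 (k + 1)) (fun ψ => ∑ Y ∈ ((polys (L ^ k) X).erase X).erase ∅,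
            bprod (L ^ k) (fun B => expNegH H B ψ - 1) (X \ Y) * K Y ψ) φ := by
    intro X hX
    obtain ⟨hXp, hXU⟩ := mem_filter.1 hX
    have hXpoly : IsPolymer (L ^ k) X := (mem_polys.1 hXp).2
    have hXne : X.Nonempty := by
      rw [nonempty_iff_ne_empty]
      intro h0
      rw [h0, reblock_empty] at hXU
      exact hUne.ne_empty hXU.symm
    exact fluct_polyP2_eq_add_add_rest_abkm hd hLodd hM hkN hp hMord hθbar hlam hB hδ₀ hδ₁ hh hh0 hA hXpoly hXne hH
      hC hK hKfac hK0 hKd hKloc φ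
  -- integrability of `e^{−H(B, φ+·)}` on blocks
  have hI : ∀ B ∈ blockPartIndex (⟨L ^ k, L, 𝒞 (k + 1), boxCorner (L ^ k) (starRad R L d k) x₀, blockOf (L ^ k) x₀⟩ :
        StepData d M) U,
      Integrable (fun ξ => expNegH H B (φ + ξ)) (stepMeasure (𝒞 (k + 1))) := by
    intro B hB'
    have hBb := blockPartIndex_subset_blocks _ U hB'
    obtain ⟨y, -, rfl⟩ := mem_blocks.1 hBb
    have hBS : blockOf (L ^ k) y ⊆ thicken (P.rad k) (blockOf (L ^ k) y) := subset_thicken _ _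
    have hcard : (blockOf (L ^ k) y).card = L ^ (d * k) := by
      rw [TorusPolymer.card_blockOf hMt hLodd.pow htodd y, ← pow_mul, mul_comm]
    have hHB : hamNorm (fieldWt h (L : ℝ) d k) ((L : ℝ) ^ k) (blockOf (L ^ k) y).card H ≤ 1 / 8 := by
      rw [hcard]; exact hH
    have hs := tayNormLE_expNegH_strong_abkm (R := R) (Mord := Mord) hd hLodd hM hk hh hMord hp hBS r₀ hHB
    have hgauge : P.gauge k (blockOf (L ^ k) y) =
        fieldGauge (fieldWt h (L : ℝ) d k) ((L : ℝ) ^ k) p (thicken (P.rad k) (blockOf (L ^ k) y)) := rfl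
    rw [← hgauge] at hs
    have hSW : ∀ ψ, expWeight (strongCoef h N k • derivForm (L : ℝ) k (diffIndex d Mord)
        (boxDensity (boxRad R L k) (boxWt (L : ℝ) d k) (blockOf (L ^ k) y))) ψ ≤ W.weight k (blockOf (L ^ k) y) ψ :=
      fun ψ => strongWeight_le_weight_abkm hB hδ₀ hδ₁ hh hh0 k (subset_refl _) ψ
    have hev : IsGaugeLocal (P.gauge k (blockOf (L ^ k) y)) (fun φ : (Fin d → ZMod M) → ℝ => eval H (blockOf (L ^ k) y) φ) := by
      rw [hgauge]; exact isGaugeLocal_eval h𝔥.ne' hRk.ne' hp hBS H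
    have hexp_loc : IsGaugeLocal (P.gauge k (blockOf (L ^ k) y)) (expNegH H (blockOf (L ^ k) y)) :=
      fun φ ψ hT => by simp only [expNegH, hev φ ψ hT]
    have hexp_d : ContDiff ℝ r₀ (expNegH H (blockOf (L ^ k) y)) := by
      show ContDiff ℝ r₀ (fun φ : (Fin d → ZMod M) → ℝ => Complex.exp (-(eval H (blockOf (L ^ k) y) φ)))
      exact (contDiff_eval H _ (n := r₀)).neg.cexp
    exact integrable_comp_add_of_tayNormLE (hs.mono_weight (Real.exp_pos _).le hSW) (Real.exp_pos _).le hexp_d hexp_loc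
      (weightSectionDominated_abkm hθbar hlam hB hk1 _ (P.gauge k _)) φ
  -- the identity of RenormalisationMapRemainder and the regrouping of the second sum
  have hmain := nextKStep_sub_opC_eq ⟨L ^ k, L, 𝒞 (k + 1), boxCorner (L ^ k) (starRad R L d k) x₀, blockOf (L ^ k) x₀⟩
    hMo hsodd hLodd hC𝒞 hBne hroomB H K hK0 hUne φ hint hsplit hI
  simp only at hmain
  have hlarge : ∀ X ∈ largePartIndex (L ^ k) L U,
      fluct (𝒞 (k + 1)) (polyP2 (L ^ k) H K X) φ =
        fluct (𝒞 (k + 1)) (K X) φ + fluct (𝒞 (k + 1)) (fun ψ => bprod (L ^ k) (fun B => expNegH H B ψ - 1) X) φ +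
          fluct (𝒞 (k + 1)) (fun ψ => ∑ Y ∈ ((polys (L ^ k) X).erase X).erase ∅,
            bprod (L ^ k) (fun B => expNegH H B ψ - 1) (X \ Y) * K Y ψ) φ := by
    intro X hX
    obtain ⟨hXp, -, -, hXU⟩ := mem_largePartIndex.1 hX
    exact hsplit X (mem_filter.2 ⟨mem_polys.2 ⟨subset_univ _, hXp⟩, hXU⟩)
  have hreg := sum_large_regroup (largePartIndex (L ^ k) L U)
    (fun X => bprod (L ^ k) (fun B => expNegH (nextH ⟨L ^ k, L, 𝒞 (k + 1), boxCorner (L ^ k) (starRad R L d k) x₀,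
        blockOf (L ^ k) x₀⟩ H K) B φ) (U \ X) *
      bprod (L ^ k) (fun B => expNegH (-(nextH ⟨L ^ k, L, 𝒞 (k + 1), boxCorner (L ^ k) (starRad R L d k) x₀,
        blockOf (L ^ k) x₀⟩ H K)) B φ) (X \ U))
    (fun X => fluct (𝒞 (k + 1)) (K X) φ)
    (fun X => fluct (𝒞 (k + 1)) (fun ψ => bprod (L ^ k) (fun B => expNegH H B ψ - 1) X) φ)
    (fun X => fluct (𝒞 (k + 1)) (fun ψ => ∑ Y ∈ ((polys (L ^ k) X).erase X).erase ∅,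
      bprod (L ^ k) (fun B => expNegH H B ψ - 1) (X \ Y) * K Y ψ) φ)
    (fun X => bprod (L ^ k) (fun B => 1 - expNegH (nextH ⟨L ^ k, L, 𝒞 (k + 1), boxCorner (L ^ k) (starRad R L d k) x₀,
        blockOf (L ^ k) x₀⟩ H K) B φ) X)
    (fun X => fluct (𝒞 (k + 1)) (polyP2 (L ^ k) H K X) φ) hlarge
  rw [hreg] at hmain
  have hopC : opC ⟨L ^ k, L, 𝒞 (k + 1), boxCorner (L ^ k) (starRad R L d k) x₀, blockOf (L ^ k) x₀⟩ K U φ =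
      blockPart ⟨L ^ k, L, 𝒞 (k + 1), boxCorner (L ^ k) (starRad R L d k) x₀, blockOf (L ^ k) x₀⟩ K U φ +
        ∑ X ∈ largePartIndex (L ^ k) L U, fluct (𝒞 (k + 1)) (K X) φ := rfl
  rw [hopC] at hmain
  linear_combination hmain

end Literature.MathematicalPhysics.StatisticalMechanics.GradientRG

end
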